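import Mathlib
import Summits.Ventures.PercRepro2.CoinChainReductionGen
import Summits.Ventures.PercRepro2.CoinChainHeadHyps
import Summits.Ventures.PercRepro2.CoinChainGeneralEnt
import Summits.Ventures.PercRepro2.CoinChainAWorldGen
import Summits.Ventures.PercRepro2.CoinChainAWorldGen

/-!
# Row 2′DARC at the GENERAL AND-switch chain — the coin-system corollaries
(blind cell PercRepro2, night-2 g19; proofs/NIGHT2-DARC.md §59.17)

The general chain: `a'` entered from `ent' ⊆ U` by sure coins, `a` entered from `ent ⊆ U` by
sure coins AND from `a'` by one random coin, any log-supermodular core, markers anywhere in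
`U`, any head.  Through `chain_darc_of_functional` the three general-ent conditions become
row-level statements: `darc_of_chain_of_odds` (the four-atom odds conditions),
`darc_of_chain_of_noPivot00` (no pivotality on the marker-free clusters meeting `ent ∪ ent'`),
`darc_of_chain_of_decreasing` (the gate density decreasing), `darc_of_chain_of_covA` (numeric:
the A-law marker covariance nonnegative), `darc_of_chain_of_diffLsm` (`c − d` log-supermodular).
-/

namespace Summit.Ventures.PercRepro2.Coin

section ChainGeneralDarc

variable {V : Type*} {E : Type*} [Fintype V] [DecidableEq V] [Fintype E] [DecidableEq E]
  {R : Type*} [Field R] [LinearOrder R] [IsStrictOrderedRing R]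
  {arcs : E → Finset (V × V)} {s : V} {U : Finset V} {ent ent' : Finset V} {c' : V → E}
  {a' a w : V} {c : V → E}

/-- **ROW 2′DARC AT THE GENERAL CHAIN under the four-atom odds conditions** (numeric): the gate's
odds of «the first marker alone» against «neither marker» are at most the `R`-law's odds of
the first marker, and symmetrically for the second — the strongest single numeric condition on
the exact census (739 / 750). -/
theorem darc_of_chain_of_odds (pr : E → R) (hp : IsProbVec pr) (hS : SameEnds arcs)
    (h' : OrTailK arcs s U ent' c' a') (hsure' : ∀ r ∈ ent', pr (c' r) = 1)
    (h : OrTailK arcs s (insert a' U) (insert a' ent) c a) (hsure : ∀ r ∈ ent, pr (c r) = 1)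
    (hentU : ent ⊆ U)
    {m₁ m₂ : V} (hm₁ : m₁ ∈ U) (hm₂ : m₂ ∈ U)
    (hν : ∀ W W', W ⊆ U → W' ⊆ U →
      prob pr (coreLevel arcs s U W) * prob pr (coreLevel arcs s U W') ≤
        prob pr (coreLevel arcs s U (W ∩ W')) * prob pr (coreLevel arcs s U (W ∪ W')))
    {t : V} (htC : t ∉ insert a (insert a' U)) (hts : t ≠ s) (hws : w ≠ s)
    (hwC : w ∉ insert a (insert a' U))
    (hodd₁ : (∑ W ∈ U.powerset, prob pr (coreLevel arcs s U W) * chainMix ent ent' (pr (c a')) (chainC pr arcs s t U ent' a' a) (chainD' pr arcs s t U ent' a' a w) W *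
          ((if m₁ ∈ W then (1 : R) else 0) * (1 - if m₂ ∈ W then (1 : R) else 0))) *
        (∑ W ∈ U.powerset, prob pr (coreLevel arcs s U W) * chainMix ent ent' (pr (c a')) (chainC pr arcs s t U ent' a' a) (chainD pr arcs s t U ent' a' a) W *
          (1 - if m₁ ∈ W then (1 : R) else 0)) ≤
      (∑ W ∈ U.powerset, prob pr (coreLevel arcs s U W) * chainMix ent ent' (pr (c a')) (chainC pr arcs s t U ent' a' a) (chainD' pr arcs s t U ent' a' a w) W *
          ((1 - if m₁ ∈ W then (1 : R) else 0) * (1 - if m₂ ∈ W then (1 : R) else 0))) *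
        (∑ W ∈ U.powerset, prob pr (coreLevel arcs s U W) * chainMix ent ent' (pr (c a')) (chainC pr arcs s t U ent' a' a) (chainD pr arcs s t U ent' a' a) W *
          (if m₁ ∈ W then (1 : R) else 0)))
    (hodd₂ : (∑ W ∈ U.powerset, prob pr (coreLevel arcs s U W) * chainMix ent ent' (pr (c a')) (chainC pr arcs s t U ent' a' a) (chainD' pr arcs s t U ent' a' a w) W *
          ((1 - if m₁ ∈ W then (1 : R) else 0) * (if m₂ ∈ W then (1 : R) else 0))) *
        (∑ W ∈ U.powerset, prob pr (coreLevel arcs s U W) * chainMix ent ent' (pr (c a')) (chainC pr arcs s t U ent' a' a) (chainD pr arcs s t U ent' a' a) W *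
          (1 - if m₂ ∈ W then (1 : R) else 0)) ≤
      (∑ W ∈ U.powerset, prob pr (coreLevel arcs s U W) * chainMix ent ent' (pr (c a')) (chainC pr arcs s t U ent' a' a) (chainD' pr arcs s t U ent' a' a w) W *
          ((1 - if m₁ ∈ W then (1 : R) else 0) * (1 - if m₂ ∈ W then (1 : R) else 0))) *
        (∑ W ∈ U.powerset, prob pr (coreLevel arcs s U W) * chainMix ent ent' (pr (c a')) (chainC pr arcs s t U ent' a' a) (chainD pr arcs s t U ent' a' a) W *
          (if m₂ ∈ W then (1 : R) else 0))) :
    DARC pr arcs s {t} m₁ m₂ a w := by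
  obtain ⟨hA0, hAmono, hAlsm⟩ := OrTailU.head_props (U := insert a' U) (a := a) pr hp hS t
  obtain ⟨hdc, hd'd, hcc, -, hd'd', -, -, hratio', -, -, hcd'⟩ :=
    chainPhi_head_hyps (fun X => prob pr (coreAvoidEvent arcs s t (insert a (insert a' U)) X))
      ent' a' a w hA0 hAmono hAlsm
  refine chain_darc_of_functional pr hS h' hsure' h hsure hentU hm₁ hm₂ htC hts hws hwC ?_
  exact chain_functional_nonneg_of_odds U ent ent' (fun W => prob pr (coreLevel arcs s U W))
    (chainC pr arcs s t U ent' a' a) (chainD pr arcs s t U ent' a' a) (chainD' pr arcs s t U ent' a' a w)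
    (pr (c a')) (hp.nonneg _) (hp.le_one _) (fun W => prob_nonneg hp _)
    (fun s' hs' t' ht' => hν s' t' hs' ht') (fun W => hA0 _) (fun W => hA0 _) (fun W => hA0 _)
    (fun W => le_trans (hd'd W) (hdc W)) hcc hd'd' hcd' hratio' m₁ m₂ hodd₁ hodd₂

/-- **ROW 2′DARC AT THE GENERAL CHAIN when no marker-free cluster is pivotal**: `chainD' = chainD` on
every entered cluster missing both markers (e.g. the entries not covered by the markers are
head-blind and `w` reaches the target only when `a` does) — the four-atom sandwich. -/
theorem darc_of_chain_of_noPivot00 (pr : E → R) (hp : IsProbVec pr) (hS : SameEnds arcs)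
    (h' : OrTailK arcs s U ent' c' a') (hsure' : ∀ r ∈ ent', pr (c' r) = 1)
    (h : OrTailK arcs s (insert a' U) (insert a' ent) c a) (hsure : ∀ r ∈ ent, pr (c r) = 1)
    (hentU : ent ⊆ U)
    {m₁ m₂ : V} (hm₁ : m₁ ∈ U) (hm₂ : m₂ ∈ U)
    (hν : ∀ W W', W ⊆ U → W' ⊆ U →
      prob pr (coreLevel arcs s U W) * prob pr (coreLevel arcs s U W') ≤
        prob pr (coreLevel arcs s U (W ∩ W')) * prob pr (coreLevel arcs s U (W ∪ W')))
    {t : V} (htC : t ∉ insert a (insert a' U)) (hts : t ≠ s) (hws : w ≠ s)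
    (hwC : w ∉ insert a (insert a' U))
    (h00 : ∀ W ⊆ U, m₁ ∉ W → m₂ ∉ W → (∃ r ∈ ent ∪ ent', r ∈ W) →
      chainD' pr arcs s t U ent' a' a w W = chainD pr arcs s t U ent' a' a W) :
    DARC pr arcs s {t} m₁ m₂ a w := by
  obtain ⟨hA0, hAmono, hAlsm⟩ := OrTailU.head_props (U := insert a' U) (a := a) pr hp hS t
  obtain ⟨hdc, hd'd, hcc, hdd, hd'd', -, hratio, hratio', -, hcd, hcd'⟩ :=
    chainPhi_head_hyps (fun X => prob pr (coreAvoidEvent arcs s t (insert a (insert a' U)) X))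
      ent' a' a w hA0 hAmono hAlsm
  refine chain_darc_of_functional pr hS h' hsure' h hsure hentU hm₁ hm₂ htC hts hws hwC ?_
  exact chain_functional_nonneg_of_noPivot00 U ent ent' (fun W => prob pr (coreLevel arcs s U W))
    (chainC pr arcs s t U ent' a' a) (chainD pr arcs s t U ent' a' a) (chainD' pr arcs s t U ent' a' a w)
    (pr (c a')) (hp.nonneg _) (hp.le_one _) (fun W => prob_nonneg hp _)
    (fun s' hs' t' ht' => hν s' t' hs' ht') (fun W => hA0 _) (fun W => hA0 _) (fun W => hA0 _)
    hdc (fun W => le_trans (hd'd W) (hdc W)) hd'd hcc hdd hd'd' hcd hcd' hratio hratio' m₁ m₂ h00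

/-- **ROW 2′DARC AT THE GENERAL CHAIN under the decreasing-density hypothesis**: the gate density
`chainMix ρ chainC chainD' / chainMix ρ chainC chainD` is decreasing along inclusion (cleared
form) — e.g. whenever `w` reaches the target independently of the core. -/
theorem darc_of_chain_of_decreasing (pr : E → R) (hp : IsProbVec pr) (hS : SameEnds arcs)
    (h' : OrTailK arcs s U ent' c' a') (hsure' : ∀ r ∈ ent', pr (c' r) = 1)
    (h : OrTailK arcs s (insert a' U) (insert a' ent) c a) (hsure : ∀ r ∈ ent, pr (c r) = 1)
    (hentU : ent ⊆ U)
    {m₁ m₂ : V} (hm₁ : m₁ ∈ U) (hm₂ : m₂ ∈ U)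
    (hν : ∀ W W', W ⊆ U → W' ⊆ U →
      prob pr (coreLevel arcs s U W) * prob pr (coreLevel arcs s U W') ≤
        prob pr (coreLevel arcs s U (W ∩ W')) * prob pr (coreLevel arcs s U (W ∪ W')))
    {t : V} (htC : t ∉ insert a (insert a' U)) (hts : t ≠ s) (hws : w ≠ s)
    (hwC : w ∉ insert a (insert a' U))
    (hdec : ∀ s' t', s' ⊆ t' →
      chainMix ent ent' (pr (c a')) (chainC pr arcs s t U ent' a' a) (chainD' pr arcs s t U ent' a' a w) t' *
        chainMix ent ent' (pr (c a')) (chainC pr arcs s t U ent' a' a) (chainD pr arcs s t U ent' a' a) s' ≤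
      chainMix ent ent' (pr (c a')) (chainC pr arcs s t U ent' a' a) (chainD' pr arcs s t U ent' a' a w) s' *
        chainMix ent ent' (pr (c a')) (chainC pr arcs s t U ent' a' a) (chainD pr arcs s t U ent' a' a) t') :
    DARC pr arcs s {t} m₁ m₂ a w := by
  obtain ⟨hA0, hAmono, hAlsm⟩ := OrTailU.head_props (U := insert a' U) (a := a) pr hp hS t
  obtain ⟨hdc, hd'd, hcc, hdd, hd'd', hdd', hratio, hratio', hratio'', hcd, hcd'⟩ :=
    chainPhi_head_hyps (fun X => prob pr (coreAvoidEvent arcs s t (insert a (insert a' U)) X))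
      ent' a' a w hA0 hAmono hAlsm
  refine chain_darc_of_functional pr hS h' hsure' h hsure hentU hm₁ hm₂ htC hts hws hwC ?_
  exact chain_functional_nonneg_of_decreasing U ent ent' (fun W => prob pr (coreLevel arcs s U W))
    (chainC pr arcs s t U ent' a' a) (chainD pr arcs s t U ent' a' a) (chainD' pr arcs s t U ent' a' a w)
    (pr (c a')) (hp.nonneg _) (hp.le_one _) (fun W => prob_nonneg hp _)
    (fun s' hs' t' ht' => hν s' t' hs' ht') (fun W => hA0 _) (fun W => hA0 _) (fun W => hA0 _)
    hdc (fun W => le_trans (hd'd W) (hdc W)) hd'd hcc hdd hd'd' hcd hcd' hratio hratio' hdec m₁ m₂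

/-- **ROW 2′DARC AT THE GENERAL CHAIN under the numeric A-covariance hypothesis**: the two markers
have nonnegative covariance under the A-law `ν · (1 − θ) · (chainC − chainD)` (cleared form). -/
theorem darc_of_chain_of_covA (pr : E → R) (hp : IsProbVec pr) (hS : SameEnds arcs)
    (h' : OrTailK arcs s U ent' c' a') (hsure' : ∀ r ∈ ent', pr (c' r) = 1)
    (h : OrTailK arcs s (insert a' U) (insert a' ent) c a) (hsure : ∀ r ∈ ent, pr (c r) = 1)
    (hentU : ent ⊆ U)
    {m₁ m₂ : V} (hm₁ : m₁ ∈ U) (hm₂ : m₂ ∈ U)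
    (hν : ∀ W W', W ⊆ U → W' ⊆ U →
      prob pr (coreLevel arcs s U W) * prob pr (coreLevel arcs s U W') ≤
        prob pr (coreLevel arcs s U (W ∩ W')) * prob pr (coreLevel arcs s U (W ∪ W')))
    {t : V} (htC : t ∉ insert a (insert a' U)) (hts : t ≠ s) (hws : w ≠ s)
    (hwC : w ∉ insert a (insert a' U))
    (hD : (∑ W ∈ U.powerset, prob pr (coreLevel arcs s U W) *
            ((1 - chainTheta ent ent' (pr (c a')) W) *
              (chainC pr arcs s t U ent' a' a W - chainD pr arcs s t U ent' a' a W)) *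
            (if m₁ ∈ W then (1 : R) else 0)) *
          (∑ W ∈ U.powerset, prob pr (coreLevel arcs s U W) *
            ((1 - chainTheta ent ent' (pr (c a')) W) *
              (chainC pr arcs s t U ent' a' a W - chainD pr arcs s t U ent' a' a W)) *
            (if m₂ ∈ W then (1 : R) else 0)) ≤
        (∑ W ∈ U.powerset, prob pr (coreLevel arcs s U W) *
            ((1 - chainTheta ent ent' (pr (c a')) W) *
              (chainC pr arcs s t U ent' a' a W - chainD pr arcs s t U ent' a' a W))) *
          (∑ W ∈ U.powerset, prob pr (coreLevel arcs s U W) *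
            ((1 - chainTheta ent ent' (pr (c a')) W) *
              (chainC pr arcs s t U ent' a' a W - chainD pr arcs s t U ent' a' a W)) *
            ((if m₁ ∈ W then (1 : R) else 0) * (if m₂ ∈ W then (1 : R) else 0)))) :
    DARC pr arcs s {t} m₁ m₂ a w := by
  obtain ⟨hA0, hAmono, hAlsm⟩ := OrTailU.head_props (U := insert a' U) (a := a) pr hp hS t
  obtain ⟨hdc, hd'd, hcc, hdd, hd'd', hdd', hratio, hratio', hratio'', -, -⟩ :=
    chainPhi_head_hyps (fun X => prob pr (coreAvoidEvent arcs s t (insert a (insert a' U)) X))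
      ent' a' a w hA0 hAmono hAlsm
  refine chain_darc_of_functional pr hS h' hsure' h hsure hentU hm₁ hm₂ htC hts hws hwC ?_
  exact chain_functional_nonneg_of_covA U ent ent' (fun W => prob pr (coreLevel arcs s U W))
    (chainC pr arcs s t U ent' a' a) (chainD pr arcs s t U ent' a' a) (chainD' pr arcs s t U ent' a' a w)
    (pr (c a')) (hp.nonneg _) (hp.le_one _) (fun W => prob_nonneg hp _)
    (fun s' hs' t' ht' => hν s' t' hs' ht') (fun W => hA0 _) (fun W => hA0 _) (fun W => hA0 _)
    hdc hd'd hcc hdd hd'd' hdd' hratio hratio' hratio'' m₁ m₂ hD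

/-- **ROW 2′DARC AT THE GENERAL AND-SWITCH CHAIN (coin system), under the difference hypotheses.**
`a'` an OR-vertex entered from `ent' ⊆ U` by sure coins, `a` entered from `a'` alone by one
random coin, the cluster law of `U` log-supermodular, markers `m₁, m₂ ∈ U`, `t, w` outside the
core; the head function `A X = P(X avoids t)` with its `a`-difference `A X − A (X ∪ {a})`
log-supermodular (`hDlsm`; it is antitone for every head, `coreAvoid_diff_anti`).  Then
`Φ_D({s ↛ t in D + (a → w)}) ≥ 0`. -/
theorem darc_of_chain_of_diffLsm (pr : E → R) (hp : IsProbVec pr) (hS : SameEnds arcs)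
    (h' : OrTailK arcs s U ent' c' a') (hsure' : ∀ r ∈ ent', pr (c' r) = 1)
    (h : OrTailK arcs s (insert a' U) (insert a' ent) c a) (hsure : ∀ r ∈ ent, pr (c r) = 1)
    (hentU : ent ⊆ U)
    {m₁ m₂ : V} (hm₁ : m₁ ∈ U) (hm₂ : m₂ ∈ U)
    (hν : ∀ W W', W ⊆ U → W' ⊆ U →
      prob pr (coreLevel arcs s U W) * prob pr (coreLevel arcs s U W') ≤
        prob pr (coreLevel arcs s U (W ∩ W')) * prob pr (coreLevel arcs s U (W ∪ W')))
    {t : V} (htC : t ∉ insert a (insert a' U)) (hts : t ≠ s) (hws : w ≠ s)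
    (hwC : w ∉ insert a (insert a' U))
    (hDlsm : ∀ X Y : Finset V,
      (prob pr (coreAvoidEvent arcs s t (insert a (insert a' U)) X) -
        prob pr (coreAvoidEvent arcs s t (insert a (insert a' U)) (X ∪ {a}))) *
      (prob pr (coreAvoidEvent arcs s t (insert a (insert a' U)) Y) -
        prob pr (coreAvoidEvent arcs s t (insert a (insert a' U)) (Y ∪ {a}))) ≤
      (prob pr (coreAvoidEvent arcs s t (insert a (insert a' U)) (X ∩ Y)) -
        prob pr (coreAvoidEvent arcs s t (insert a (insert a' U)) (X ∩ Y ∪ {a}))) *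
      (prob pr (coreAvoidEvent arcs s t (insert a (insert a' U)) (X ∪ Y)) -
        prob pr (coreAvoidEvent arcs s t (insert a (insert a' U)) (X ∪ Y ∪ {a})))) :
    DARC pr arcs s {t} m₁ m₂ a w := by
  obtain ⟨hA0, hAmono, hAlsm⟩ := OrTailU.head_props (U := insert a' U) (a := a) pr hp hS t
  obtain ⟨hdc, hd'd, hcc, hdd, hd'd', hdd', hratio, hratio', hratio'', -, -⟩ :=
    chainPhi_head_hyps (fun X => prob pr (coreAvoidEvent arcs s t (insert a (insert a' U)) X))
      ent' a' a w hA0 hAmono hAlsm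
  have hφu := chainPhi_union ent' a'
  have hφi := chainPhi_inter ent' a'
  have hD0 : ∀ X, 0 ≤ prob pr (coreAvoidEvent arcs s t (insert a (insert a' U)) X) -
      prob pr (coreAvoidEvent arcs s t (insert a (insert a' U)) (X ∪ {a})) := fun X => by
    linarith [hAmono X (X ∪ {a}) Finset.subset_union_left]
  refine chain_darc_of_functional pr hS h' hsure' h hsure hentU hm₁ hm₂ htC hts hws hwC ?_
  refine chain_functional_nonneg_of_diffLsm U ent ent' (fun W => prob pr (coreLevel arcs s U W))
    (chainC pr arcs s t U ent' a' a) (chainD pr arcs s t U ent' a' a) (chainD' pr arcs s t U ent' a' a w)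
    (pr (c a')) (hp.nonneg _) (hp.le_one _) (fun W => prob_nonneg hp _)
    (fun s' hs' t' ht' => hν s' t' hs' ht') (fun W => hA0 _) (fun W => hA0 _) (fun W => hA0 _)
    hdc hd'd hcc hdd hd'd' hdd' hratio hratio' hratio'' ?_ m₁ m₂
  intro s' t'
  have h1 := hDlsm (chainPhi ent' a' s') (chainPhi ent' a' t')
  have h2 := coreAvoid_diff_anti (R := R) pr hp arcs s t (insert a (insert a' U)) a (hφi s' t')
  unfold chainC chainD
  rw [hφu]
  exact le_trans h1 (mul_le_mul_of_nonneg_right h2 (hD0 _))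

end ChainGeneralDarc

end Summit.Ventures.PercRepro2.Coin
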